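import Literature.NumberTheory.Sieve.QuadraticRootsLevelAxis
import HarnessLib

/-!
# The axis of an indefinite form, II: parametrisation of the geodesic and the Pell dilation

Topic `Literature/NumberTheory/Sieve`, continuation of `QuadraticRootsLevelAxis.lean` (Tóth's
positive-discriminant case).  For `Q = [A, B, C]` with `A > 0`, `Δ > 0` the Cayley coordinate
`c_Q(z) = (z − θ₊)/(z − θ₋)` is injective on `ℍ` and carries the geodesic `S_Q` onto the positive
imaginary axis; inverting it gives the **parametrisation** `t ↦ P_Q(t) = c_Q⁻¹(it)` (`t > 0`) of
`S_Q`, in which the automorph `U(x, y)` of a Pell solution acts as `t ↦ (x − y√Δ)² t`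
(`QuadraticRootsLevelAxis.cayley_automorph_smul`).  Everything here is proved:

* `cayley_injective_of_im_ne` — `c_Q` is injective off the real axis (`θ₊ ≠ θ₋`);
* `axisPt Q t = ((θ₊ + t²θ₋) + i t(θ₊ − θ₋))/(1 + t²) ∈ ℍ` for `t > 0`, with
  **`cayley_axisPt : c_Q(P_Q(t)) = it`**, `axisPt_mem_geod : P_Q(t) ∈ S_Q`, and
  **`exists_axisPt_eq : z ∈ S_Q → ∃ t > 0, P_Q(t) = z`** (so `S_Q = {P_Q(t) : t > 0}`,
  `geod_eq_range_axisPt`);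
* **`automorph_smul_axisPt : U(x, y) • P_Q(t) = P_Q((x − y√Δ)² t)`** and its iterate
  `automorph_pow_smul_axisPt` for `U^k` — the deck transformations of the closed geodesic are the
  dilations by the even powers of the unit.

## References

* Á. Tóth, *Roots of quadratic congruences*, IMRN 2000, no. 14, 719–739 (positive discriminant:
  closed geodesics; cite-only in the store, cf. [cite: Ngo2024, §1]). [cite: Toth2000, main theorem]
* W. Duke, J. B. Friedlander, H. Iwaniec, Ann. of Math. (2) 141 (1995), §2 p. 427 (the model
  construction for `Δ < 0`). [cite: DukeFriedlanderIwaniec1995, §2 p. 427]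
-/

noncomputable section

namespace Literature.NumberTheory.Sieve

open scoped MatrixGroups UpperHalfPlane
open Literature.NumberTheory.QuadraticFields.Quadratic (BinQF)
open UpperHalfPlane

namespace RootForms

variable {Q : BinQF}

/-! ### Injectivity of the Cayley coordinate -/

/-- `c_Q` is injective off the real axis: `(z − θ₊)(z' − θ₋) = (z' − θ₊)(z − θ₋)` forces
`(θ₊ − θ₋)(z − z') = 0`. [folklore] -/
theorem cayley_injective_of_im_ne (hA : Q.a ≠ 0) (hΔ : 0 < Q.disc) {z z' : ℂ} (hz : z.im ≠ 0)
    (hz' : z'.im ≠ 0) (h : cayley Q z = cayley Q z') : z = z' := by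
  have h1 : z - (rootMinus Q : ℂ) ≠ 0 := sub_real_ne_zero hz _
  have h2 : z' - (rootMinus Q : ℂ) ≠ 0 := sub_real_ne_zero hz' _
  rw [cayley, cayley, div_eq_div_iff h1 h2] at h
  have hθ : (rootPlus Q : ℂ) - rootMinus Q ≠ 0 := by
    have := rootPlus_ne_rootMinus hA hΔ
    exact_mod_cast sub_ne_zero.2 this
  have key : ((rootPlus Q : ℂ) - rootMinus Q) * (z - z') = 0 := by linear_combination h
  rcases mul_eq_zero.1 key with h0 | h0
  · exact absurd h0 hθ
  · exact sub_eq_zero.1 h0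

/-- `c_Q` is injective on `ℍ`. [folklore] -/
theorem cayley_injOn (hA : Q.a ≠ 0) (hΔ : 0 < Q.disc) {z z' : ℍ}
    (h : cayley Q z = cayley Q z') : z = z' := by
  apply UpperHalfPlane.ext
  refine cayley_injective_of_im_ne hA hΔ ?_ ?_ h
  · rw [UpperHalfPlane.coe_im]; exact z.im_pos.ne'
  · rw [UpperHalfPlane.coe_im]; exact z'.im_pos.ne'

/-! ### The parametrisation `t ↦ c_Q⁻¹(it)` of the geodesic -/

/-- The point `P_Q(t) = c_Q⁻¹(it) = ((θ₊ + t²θ₋) + i t(θ₊ − θ₋))/(1 + t²)` as a complex number.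
[folklore] -/
def axisPtC (Q : BinQF) (t : ℝ) : ℂ :=
  (((rootPlus Q + t ^ 2 * rootMinus Q) / (1 + t ^ 2) : ℝ) : ℂ) +
    ((t * (rootPlus Q - rootMinus Q) / (1 + t ^ 2) : ℝ) : ℂ) * Complex.I

/-- Real part of `P_Q(t)`. [folklore] -/
@[simp] theorem axisPtC_re (t : ℝ) :
    (axisPtC Q t).re = (rootPlus Q + t ^ 2 * rootMinus Q) / (1 + t ^ 2) := by
  simp only [axisPtC, Complex.add_re, Complex.ofReal_re, Complex.mul_re, Complex.I_re,
    Complex.ofReal_im, Complex.I_im, mul_zero, mul_one, sub_self, add_zero]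

/-- Imaginary part of `P_Q(t)`. [folklore] -/
@[simp] theorem axisPtC_im (t : ℝ) :
    (axisPtC Q t).im = t * (rootPlus Q - rootMinus Q) / (1 + t ^ 2) := by
  simp only [axisPtC, Complex.add_im, Complex.ofReal_im, Complex.mul_im, Complex.I_re,
    Complex.ofReal_re, Complex.I_im, mul_zero, mul_one, zero_add, add_zero]

/-- `Im P_Q(t) > 0` for `t > 0`, `A > 0`, `Δ > 0` (`θ₊ > θ₋`). [folklore] -/
theorem axisPtC_im_pos (hA : 0 < Q.a) (hΔ : 0 < Q.disc) {t : ℝ} (ht : 0 < t) :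
    0 < (axisPtC Q t).im := by
  rw [axisPtC_im, rootPlus_sub_rootMinus hA.ne']
  have hA' : (0 : ℝ) < Q.a := by exact_mod_cast hA
  have := sqrtDisc_pos hΔ
  positivity

/-- **The parametrisation of the geodesic**: `P_Q(t) ∈ ℍ` for `t > 0`. [cite: Toth2000, main theorem (closed geodesics; cf. Ngo2024 §1)] -/
def axisPt (Q : BinQF) (hA : 0 < Q.a) (hΔ : 0 < Q.disc) (t : ℝ) (ht : 0 < t) : ℍ :=
  ⟨axisPtC Q t, axisPtC_im_pos hA hΔ ht⟩

/-- The underlying complex number of `axisPt`. [folklore] -/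
@[simp] theorem coe_axisPt (hA : 0 < Q.a) (hΔ : 0 < Q.disc) {t : ℝ} (ht : 0 < t) :
    ((axisPt Q hA hΔ t ht : ℍ) : ℂ) = axisPtC Q t := rfl

/-- **`c_Q(P_Q(t)) = it`**. [folklore] -/
theorem cayley_axisPtC (hA : Q.a ≠ 0) (hΔ : 0 < Q.disc) {t : ℝ} (ht : 0 < t) :
    cayley Q (axisPtC Q t) = Complex.I * t := by
  have hθ : rootPlus Q - rootMinus Q ≠ 0 := sub_ne_zero.2 (rootPlus_ne_rootMinus hA hΔ)
  have ht2 : (1 + t ^ 2 : ℝ) ≠ 0 := by positivity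
  -- `P − θ₋ = (θ₊ − θ₋)(1 + it)/(1 + t²)` and `P − θ₊ = (θ₊ − θ₋)(it − t²)/(1 + t²) = it (P − θ₋)`
  have hden : axisPtC Q t - (rootMinus Q : ℂ) ≠ 0 := by
    intro h
    have := congrArg Complex.im h
    simp only [Complex.sub_im, axisPtC_im, Complex.ofReal_im, sub_zero, Complex.zero_im] at this
    rw [div_eq_zero_iff] at this
    rcases this with h0 | h0
    · rcases mul_eq_zero.1 h0 with h1 | h1
      · exact ht.ne' h1
      · exact hθ h1
    · exact ht2 h0
  have ht2c : (1 + (t : ℂ) ^ 2) ≠ 0 := by exact_mod_cast ht2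
  rw [cayley, div_eq_iff hden, axisPtC]
  push_cast
  field_simp
  linear_combination (-(t : ℂ) ^ 2 * (rootPlus Q - rootMinus Q)) * Complex.I_sq

/-- `c_Q(P_Q(t)) = it` on `ℍ`. [folklore] -/
theorem cayley_axisPt (hA : 0 < Q.a) (hΔ : 0 < Q.disc) {t : ℝ} (ht : 0 < t) :
    cayley Q ((axisPt Q hA hΔ t ht : ℍ) : ℂ) = Complex.I * t :=
  cayley_axisPtC hA.ne' hΔ ht

/-- **`P_Q(t)` lies on the geodesic `S_Q`.** [cite: Toth2000, main theorem (closed geodesics; cf. Ngo2024 §1)] -/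
theorem axisPt_mem_geod (hA : 0 < Q.a) (hΔ : 0 < Q.disc) {t : ℝ} (ht : 0 < t) :
    axisPt Q hA hΔ t ht ∈ geod Q := by
  rw [mem_geod_iff_re_cayley hA.ne' hΔ.le, cayley_axisPt]
  simp

/-- `t ↦ P_Q(t)` is injective on `t > 0`. [folklore] -/
theorem axisPt_injective (hA : 0 < Q.a) (hΔ : 0 < Q.disc) {t t' : ℝ} (ht : 0 < t) (ht' : 0 < t')
    (h : axisPt Q hA hΔ t ht = axisPt Q hA hΔ t' ht') : t = t' := by
  have := congrArg (fun z : ℍ => cayley Q (z : ℂ)) h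
  simp only [cayley_axisPt] at this
  have := mul_left_cancel₀ Complex.I_ne_zero this
  exact_mod_cast this

/-- **Every point of the geodesic is a `P_Q(t)`**: `z ∈ S_Q ⇒ z = P_Q(Im c_Q(z))`
(`Re c_Q(z) = 0`, `Im c_Q(z) > 0`, injectivity of `c_Q`). [cite: Toth2000, main theorem (closed geodesics; cf. Ngo2024 §1)] -/
theorem exists_axisPt_eq (hA : 0 < Q.a) (hΔ : 0 < Q.disc) {z : ℍ} (hz : z ∈ geod Q) :
    ∃ (t : ℝ) (ht : 0 < t), axisPt Q hA hΔ t ht = z := by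
  have hre : (cayley Q z).re = 0 := (mem_geod_iff_re_cayley hA.ne' hΔ.le).1 hz
  have him : 0 < (cayley Q z).im := cayley_im_pos hA hΔ z
  refine ⟨(cayley Q z).im, him, cayley_injOn hA.ne' hΔ ?_⟩
  rw [cayley_axisPt]
  apply Complex.ext
  · simp [hre]
  · simp

/-- **`S_Q = {P_Q(t) : t > 0}`.** [cite: Toth2000, main theorem (closed geodesics; cf. Ngo2024 §1)] -/
theorem geod_eq_range_axisPt (hA : 0 < Q.a) (hΔ : 0 < Q.disc) :
    geod Q = {z | ∃ (t : ℝ) (ht : 0 < t), axisPt Q hA hΔ t ht = z} := by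
  ext z
  refine ⟨exists_axisPt_eq hA hΔ, ?_⟩
  rintro ⟨t, ht, rfl⟩
  exact axisPt_mem_geod hA hΔ ht

/-! ### The automorph acts on the parametrisation by the Pell dilation -/

/-- `ε'` is multiplicative in the Pell solution (`Δ ≥ 0`). [folklore] -/
theorem pellUnitInv_mul (hΔ : 0 ≤ Q.disc) (a b : Pell.Solution₁ Q.disc) :
    pellUnitInv Q (a * b) = pellUnitInv Q a * pellUnitInv Q b := by
  have h3 := sqrtDisc_sq hΔ
  simp only [pellUnitInv, Pell.Solution₁.x_mul, Pell.Solution₁.y_mul]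
  push_cast
  linear_combination (-((a.y : ℝ) * b.y)) * h3

/-- `ε'(a^k) = ε'(a)^k`. [folklore] -/
theorem pellUnitInv_pow (hΔ : 0 ≤ Q.disc) (a : Pell.Solution₁ Q.disc) (k : ℕ) :
    pellUnitInv Q (a ^ k) = pellUnitInv Q a ^ k := by
  induction k with
  | zero => simp [pellUnitInv, Pell.Solution₁.x_one, Pell.Solution₁.y_one]
  | succ k ih => rw [pow_succ, pellUnitInv_mul hΔ, ih, pow_succ]

/-- `ε'² t > 0` for `t > 0`. [folklore] -/
theorem pellUnitInv_sq_mul_pos (hΔ : 0 ≤ Q.disc) (a : Pell.Solution₁ Q.disc) {t : ℝ} (ht : 0 < t) :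
    0 < pellUnitInv Q a ^ 2 * t :=
  mul_pos (sq_pos_iff.2 (pellUnitInv_ne_zero hΔ a)) ht

/-- **`U(x, y) • P_Q(t) = P_Q((x − y√Δ)² t)`**: on the geodesic the automorph is the dilation of
the parameter by `ε'² = (x − y√Δ)²` (a hyperbolic translation by `2|log ε'| = 2 log ε`).
[cite: Toth2000, main theorem (closed geodesics; cf. Ngo2024 §1)] -/
theorem automorph_smul_axisPt (hA : 0 < Q.a) (hΔ : 0 < Q.disc) (a : Pell.Solution₁ Q.disc)
    {t : ℝ} (ht : 0 < t) :
    automorph Q a • axisPt Q hA hΔ t ht =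
      axisPt Q hA hΔ (pellUnitInv Q a ^ 2 * t) (pellUnitInv_sq_mul_pos hΔ.le a ht) := by
  apply cayley_injOn hA.ne' hΔ
  rw [cayley_automorph_smul hA.ne' hΔ.le, cayley_axisPt, cayley_axisPt]
  push_cast
  ring

/-- The iterate: **`U(x, y)^k • P_Q(t) = P_Q((x − y√Δ)^{2k} t)`** — the deck transformations of the
closed geodesic act on the parameter by the even powers of the unit.
[cite: Toth2000, main theorem (closed geodesics; cf. Ngo2024 §1)] -/
theorem automorph_pow_smul_axisPt (hA : 0 < Q.a) (hΔ : 0 < Q.disc) (a : Pell.Solution₁ Q.disc)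
    (k : ℕ) {t : ℝ} (ht : 0 < t) :
    automorph Q a ^ k • axisPt Q hA hΔ t ht =
      axisPt Q hA hΔ (pellUnitInv Q (a ^ k) ^ 2 * t) (pellUnitInv_sq_mul_pos hΔ.le (a ^ k) ht) := by
  have h : automorph Q a ^ k = automorph Q (a ^ k) := by
    rw [← automorphHom_apply, ← automorphHom_apply, map_pow]
  rw [h]
  exact automorph_smul_axisPt hA hΔ (a ^ k) ht

/-- The parameter after `k` periods, written with `ε'^{2k}`. [folklore] -/
theorem pellUnitInv_pow_sq (hΔ : 0 ≤ Q.disc) (a : Pell.Solution₁ Q.disc) (k : ℕ) :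
    pellUnitInv Q (a ^ k) ^ 2 = pellUnitInv Q a ^ (2 * k) := by
  rw [pellUnitInv_pow hΔ, ← pow_mul, mul_comm]

end RootForms

end Literature.NumberTheory.Sieve
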